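import Literature.AnabelianGeometry.SemiGraphs.PullbackFunctor

/-!
# Vertex alignment of a finite étale covering ([SemiAnbd] §2 p. 23, Rem. 2.2.1 p. 24) — predicate

abc-iut cell, layer L3, RULING ρ2 (finder abc-iut-L6-d4, A-L6d4-G30-F2): the dictionary facts (D2)/(D3)
assert, beyond a counting bijection, that the verticial subgroups `Π_{v″} → Π_{𝒢′} → Π_𝒢` of the
covering sit inside `Π′ = ι(Π_{𝒢′})` as the DECOMPOSITION GROUPS `Π′ ∩ g⁻¹ Π_v g` — print's situation
for the covering CONSTRUCTED from `B(𝒢)_{/A}` (p. 23), but not a consequence of the local description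
`Hom.IsFiniteEtaleCoveringOf` plus the global clause (the local factorisation base points are not tied
to the global one).  This file states the alignment as a predicate, in pure group form (no component
labelling, hence no `A` argument); it stands next to `FiniteEtaleCoveringGlobalDef.lean`
(`Hom.IsGlobalCoveringOf`, `Hom.IsBranchAligned`, rulings π2/μ2) so that the covering notion of record
is «local ∧ global ∧ branch-aligned ∧ vertex-aligned» (abc-iut-L3-t1's `Hom.IsFiniteEtaleCoveringGlobal`,
Coverticial rev 4; the dictionary facts (D2)/(D3) take `φ.IsVertexAligned` as a hypothesis).  Statement
file (one `def … : Prop`, no proofs), abc-iut-L6-d4, ruling ρ2 / r87.  It is satisfied by the constructed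
covering `𝒢_A` (abc-iut-L3-t5, `coveringHom_isVertexAligned`: the vertex groups of the induced
semi-graph of anabelioids ARE the decomposition groups).  Nothing here takes a side on [IUTchIII]
Cor. 3.12; typed ≠ discharged.
-/

namespace Literature.AnabelianGeometry.SemiGraphs

open CategoryTheory CategoryTheory.PreGaloisCategory
open Literature.AnabelianGeometry.Anabelioids
open scoped Pointwise

universe v₁ u₁ u

namespace SemiGraphOfAnabelioids

variable {𝒢 𝒢' : SemiGraphOfAnabelioids.{v₁, u₁, u}}

/-- `φ : 𝒢′ → 𝒢` is **vertex-aligned** ([SemiAnbd] §2 p. 23 with Rem. 2.2.1 p. 24: "the image of each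
`Π_v` … in `Π_𝒢` is equal to the stabilizer of a compatible system of vertices"): for every base
vertex `v′` of `𝒢′` with basepoint `F′`, every basepoint `F` of `𝒢_v` (`v = φ v′`) and identification
`e : φ_{v′}^* ⋙ F′ ≅ F` — writing `ι : Π_{𝒢′} → Π_𝒢` for the induced homomorphism (as in the dictionary),
`Π′ := ι(Π_{𝒢′})` and `Πv := im(Π_v → Π_𝒢)` —
(a) the verticial subgroup of the base vertex is the decomposition group of the base pro-vertex:
`ι(Π_{v′}) = Π′ ∩ Πv`; and (b) for every vertex `v″` over `v`, every basepoint `F″` of `𝒢′_{v″}` and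
every transport `α` of basepoints of `B(𝒢′)`, the verticial subgroup of `v″` read in `Π_𝒢` is a
decomposition group `Π′ ∩ g⁻¹ Πv g` for some `g ∈ Π_𝒢`.  (Pure group form: which double coset
`Πv g Π′` belongs to which vertex is NOT recorded here; for the constructed covering `𝒢_A` it is the
double coset of the component of `A_v` labelled by `v″`.) [cite: MochizukiSemiAnbd2006, Rem. 2.2.1 p.24] -/
def Hom.IsVertexAligned (φ : Hom 𝒢' 𝒢) : Prop :=
  ∀ (v' : 𝒢'.graph.Vertex) (F' : 𝒢'.V v' ⥤ FintypeCat.{v₁}) [FiberFunctor F']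
    (F : 𝒢.V (φ.base.vertexMap v') ⥤ FintypeCat.{v₁}) [FiberFunctor F]
    (e : (φ.φV v').pullback ⋙ F' ≅ F),
    let v := φ.base.vertexMap v'
    let ι : 𝒢'.Pi v' F' →* 𝒢.Pi v F :=
      (Aut.autMulEquivOfIso (Functor.isoWhiskerLeft (𝒢.ρ v) e)).toMonoidHom.comp
        (pi1Map φ.pullbackFunctor (𝒢'.ρ v' ⋙ F'))
    let Pv : Subgroup (𝒢.Pi v F) := (𝒢.piVToPi v F).range
    (ι.comp (𝒢'.piVToPi v' F')).range = ι.range ⊓ Pv ∧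
      ∀ (v'' : {v'' : 𝒢'.graph.Vertex // φ.base.vertexMap v'' = v})
        (F'' : 𝒢'.V v''.1 ⥤ FintypeCat.{v₁}) [FiberFunctor F'']
        (α : 𝒢'.ρ v''.1 ⋙ F'' ≅ 𝒢'.ρ v' ⋙ F'),
        ∃ g : 𝒢.Pi v F,
          (ι.comp ((Aut.autMulEquivOfIso α).toMonoidHom.comp (𝒢'.piVToPi v''.1 F''))).range =
            ι.range ⊓ ConjAct.toConjAct g⁻¹ • Pv

end SemiGraphOfAnabelioids

end Literature.AnabelianGeometry.SemiGraphs
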